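import Mathlib.Probability.BrownianMotion.Basic
import Mathlib.Probability.Process.Kolmogorov
import Mathlib.Probability.Independence.Basic
import Mathlib.Topology.MetricSpace.HolderNorm
import Literature.Probability.Process.KolmogorovExtension
import HarnessLib

-- provenance: harness21/H21/H21/Prelude/Stoch/BrownianMotion.lean @ c81f080 (interim HEAD d8f2665); M5 mechanical rewrite
/-!
# Brownian motion: existence layer (Stoch trunk, prelude C2)

Mathlib (pinned commit) provides the *predicates* `ProbabilityTheory.IsPreBrownianReal X P`
(finite-dimensional laws are the Gaussian projective family
`ProbabilityTheory.BrownianReal.projectiveFamily`) and `ProbabilityTheory.IsBrownianReal X P`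
(pre-Brownian with a.s. continuous paths), for `X : ℝ≥0 → Ω → ℝ`, together with the projectivity
lemma `BrownianReal.isProjectiveMeasureFamily_projectiveFamily` and the Kolmogorov condition
predicates `IsKolmogorovProcess` / `IsAEKolmogorovProcess`. It does **not** (yet) contain the
Kolmogorov–Chentsov continuity theorem nor an existence theorem for Brownian motion.

This file adds the existence layer:

* Kolmogorov–Chentsov (index `ℝ≥0`, i.e. `d = 1`) as named facts (`def … : Prop`)
  `IsKolmogorovProcess.exists_modification_continuous` /
  `IsKolmogorovProcess.exists_modification_holderOnWith` and their `IsAEKolmogorovProcess`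
  corollaries;
* `IsPreBrownianReal.isAEKolmogorovProcess` (`E|X_t - X_s|⁴ = 3 |t - s|²`) and
  `IsPreBrownianReal.exists_modification_isBrownianReal`;
* the canonical space `ℝ≥0 → ℝ` with the product σ-algebra and the **pre-Wiener measure**
  `Literature.preWienerMeasure := Literature.projectiveLimit BrownianReal.projectiveFamily` (Kolmogorov
  extension, prelude C1), which makes the coordinate process pre-Brownian
  (`Literature.Probability.Process.isPreBrownianReal_eval`, proved);
* a chosen continuous Brownian motion `Literature.Probability.Process.brownian` on that space and its basic API;
* the planar (complex) Brownian motion predicate `Literature.Probability.Process.IsBrownianComplex`.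

## Design choices

* Dot-notation extensions of Mathlib predicates (`IsKolmogorovProcess.…`,
  `IsAEKolmogorovProcess.…`, `IsPreBrownianReal.…`) are deliberately declared in Mathlib's
  namespace `ProbabilityTheory`; everything else lives in `namespace Literature`.
* `Literature.Probability.Process.brownian` is defined by classical choice from the existence theorem
  `Literature.Probability.Process.exists_isBrownianReal_measurable_continuous`, with the **zero process** as documented junk
  value in the (impossible) other branch, so that measurability, continuity and `brownian 0 = 0`
  hold *by construction* (proved by `by_cases`), independently of the existence theorem.
* The Kolmogorov extension theorem (prelude C1, `Literature.Probability.Process.exists_isProjectiveLimit`) and the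
  Kolmogorov–Chentsov theorem are vendored as named facts (`def … : Prop`); everything about the
  pre-Wiener measure that needs the former is stated under the explicit hypothesis
  `(h : isProjectiveLimit_preWienerMeasure)` (derived from the C1 fact by
  `isProjectiveLimit_preWienerMeasure_of`; the `IsProbabilityMeasure` instance is keyed on
  `[Fact isProjectiveLimit_preWienerMeasure]`), and everything about `brownian` that needs the
  latter under `(h : exists_isBrownianReal_measurable_continuous)`.

## References

* N. Wiener, *Differential space*, J. Math. and Phys. 2 (1923), 131–174.
* O. Kallenberg, *Foundations of Modern Probability* (2nd ed., 2002), Thm 3.23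
  (Kolmogorov–Chentsov), Thm 13.5 (existence of Brownian motion).
* R. Degenne, E. Marion et al., *Formalization of Brownian motion in Lean*, arXiv:2511.20118.
-/

open MeasureTheory ProbabilityTheory ProbabilityTheory.BrownianReal
open scoped ENNReal NNReal Topology

namespace ProbabilityTheory

/-! ### Kolmogorov–Chentsov continuity theorem on `ℝ≥0` -/

section KolmogorovChentsov

variable {Ω E : Type*} {mΩ : MeasurableSpace Ω} [EMetricSpace E]
  [MeasurableSpace E] {p q : ℝ} {M : ℝ≥0} {P : Measure Ω} {X : ℝ≥0 → Ω → E}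

/- The hypotheses `[CompleteSpace E] [BorelSpace E]` are bound *inside* each fact below: a
`Prop`-valued `def` drops section instances its statement does not need to elaborate, and
without completeness the continuity theorem is false (e.g. Brownian motion viewed in
`E = ℝ ∖ {0}` satisfies the moment condition but has no continuous `E`-valued modification). -/

/-- **Kolmogorov–Chentsov continuity theorem** (`d = 1`, continuity part). Dot-notation
extension declared in Mathlib's namespace `ProbabilityTheory.IsKolmogorovProcess`.
A process `X : ℝ≥0 → Ω → E` with values in a complete (extended) metric space satisfying the
Kolmogorov condition `∫⁻ edist (X s) (X t) ^ p ∂P ≤ M * edist s t ^ q` with `q > 1` admits a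
modification `Y` all of whose paths are continuous and all of whose marginals are measurable.
Kallenberg, *Foundations of Modern Probability* (2002), Thm 3.23; Lean formalisation:
Degenne–Marion et al., arXiv:2511.20118. [cite: arXiv251120118] -/
def IsKolmogorovProcess.exists_modification_continuous : Prop :=
  ∀ [CompleteSpace E] [BorelSpace E], IsKolmogorovProcess X P p q M → 1 < q →
    ∃ Y : ℝ≥0 → Ω → E, (∀ t, Y t =ᵐ[P] X t) ∧ (∀ t, Measurable (Y t)) ∧
      ∀ ω, Continuous (Y · ω)

/-- **Kolmogorov–Chentsov continuity theorem** (`d = 1`, Hölder part). Dot-notation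
extension declared in Mathlib's namespace `ProbabilityTheory.IsKolmogorovProcess`.
Under the Kolmogorov condition with exponents `p, q`, `q > 1`, there is a modification `Y` of `X`
with continuous paths which are moreover locally `γ`-Hölder for every `γ < (q - 1) / p`.
Kallenberg, *Foundations of Modern Probability* (2002), Thm 3.23; Degenne–Marion et al.,
arXiv:2511.20118. [cite: arXiv251120118] -/
def IsKolmogorovProcess.exists_modification_holderOnWith : Prop :=
  ∀ [CompleteSpace E] [BorelSpace E], IsKolmogorovProcess X P p q M → 1 < q →
    ∃ Y : ℝ≥0 → Ω → E, (∀ t, Y t =ᵐ[P] X t) ∧ (∀ t, Measurable (Y t)) ∧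
      (∀ ω, Continuous (Y · ω)) ∧
      ∀ γ : ℝ≥0, (γ : ℝ) < (q - 1) / p → ∀ (ω : Ω) (T : ℝ≥0),
        ∃ C : ℝ≥0, HolderOnWith C γ (Y · ω) (Set.Icc 0 T)

/-- **Kolmogorov–Chentsov continuity theorem** (`d = 1`, continuity part) for processes that
are only a modification of a Kolmogorov process. Dot-notation extension declared in Mathlib's
namespace `ProbabilityTheory.IsAEKolmogorovProcess`; corollary of
`IsKolmogorovProcess.exists_modification_continuous` (see `…_holds`).
Kallenberg, *Foundations of Modern Probability* (2002), Thm 3.23.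
[cite: Kallenberg2002, Thm 3.23] -/
def IsAEKolmogorovProcess.exists_modification_continuous : Prop :=
  ∀ [CompleteSpace E] [BorelSpace E], IsAEKolmogorovProcess X P p q M → 1 < q →
    ∃ Y : ℝ≥0 → Ω → E, (∀ t, Y t =ᵐ[P] X t) ∧ (∀ t, Measurable (Y t)) ∧
      ∀ ω, Continuous (Y · ω)

/- interim proof relied on results that are now named facts (D-0014); demoted to a fact by the M5 import, proof preserved:
:= by
  obtain ⟨Y, hYX, hYm, hYc⟩ := hX.IsKolmogorovProcess_mk.exists_modification_continuous hq
  exact ⟨Y, fun t ↦ (hYX t).trans (hX.ae_eq_mk t).symm, hYm, hYc⟩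
-/

/-- `IsAEKolmogorovProcess.exists_modification_continuous` holds given the Kolmogorov–Chentsov
fact `IsKolmogorovProcess.exists_modification_continuous` for the measurable modification
`hX.mk` (the interim proof, re-threaded through the named fact).
Kallenberg, *Foundations of Modern Probability* (2002), Thm 3.23.
[cite: Kallenberg2002, Thm 3.23] -/
theorem IsAEKolmogorovProcess.exists_modification_continuous_holds
    (h : ∀ Y : ℝ≥0 → Ω → E,
      IsKolmogorovProcess.exists_modification_continuous (X := Y) (P := P) (p := p) (q := q)
        (M := M)) :
    IsAEKolmogorovProcess.exists_modification_continuous (X := X) (P := P) (p := p) (q := q)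
      (M := M) := by
  intro _ _ hX hq
  obtain ⟨Y, hYX, hYm, hYc⟩ := h hX.mk hX.IsKolmogorovProcess_mk hq
  exact ⟨Y, fun t ↦ (hYX t).trans (hX.ae_eq_mk t).symm, hYm, hYc⟩

/-- **Kolmogorov–Chentsov continuity theorem** (`d = 1`, Hölder part) for processes that are
only a modification of a Kolmogorov process. Dot-notation extension declared in Mathlib's
namespace `ProbabilityTheory.IsAEKolmogorovProcess`; corollary of
`IsKolmogorovProcess.exists_modification_holderOnWith` (see `…_holds`).
Kallenberg, *Foundations of Modern Probability* (2002), Thm 3.23.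
[cite: Kallenberg2002, Thm 3.23] -/
def IsAEKolmogorovProcess.exists_modification_holderOnWith : Prop :=
  ∀ [CompleteSpace E] [BorelSpace E], IsAEKolmogorovProcess X P p q M → 1 < q →
    ∃ Y : ℝ≥0 → Ω → E, (∀ t, Y t =ᵐ[P] X t) ∧ (∀ t, Measurable (Y t)) ∧
      (∀ ω, Continuous (Y · ω)) ∧
      ∀ γ : ℝ≥0, (γ : ℝ) < (q - 1) / p → ∀ (ω : Ω) (T : ℝ≥0),
        ∃ C : ℝ≥0, HolderOnWith C γ (Y · ω) (Set.Icc 0 T)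

/- interim proof relied on results that are now named facts (D-0014); demoted to a fact by the M5 import, proof preserved:
:= by
  obtain ⟨Y, hYX, hYm, hYc, hYh⟩ := hX.IsKolmogorovProcess_mk.exists_modification_holderOnWith hq
  exact ⟨Y, fun t ↦ (hYX t).trans (hX.ae_eq_mk t).symm, hYm, hYc, hYh⟩
-/

/-- `IsAEKolmogorovProcess.exists_modification_holderOnWith` holds given the Kolmogorov–Chentsov
fact `IsKolmogorovProcess.exists_modification_holderOnWith` for the measurable modification
`hX.mk` (the interim proof, re-threaded through the named fact).
Kallenberg, *Foundations of Modern Probability* (2002), Thm 3.23.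
[cite: Kallenberg2002, Thm 3.23] -/
theorem IsAEKolmogorovProcess.exists_modification_holderOnWith_holds
    (h : ∀ Y : ℝ≥0 → Ω → E,
      IsKolmogorovProcess.exists_modification_holderOnWith (X := Y) (P := P) (p := p) (q := q)
        (M := M)) :
    IsAEKolmogorovProcess.exists_modification_holderOnWith (X := X) (P := P) (p := p) (q := q)
      (M := M) := by
  intro _ _ hX hq
  obtain ⟨Y, hYX, hYm, hYc, hYh⟩ := h hX.mk hX.IsKolmogorovProcess_mk hq
  exact ⟨Y, fun t ↦ (hYX t).trans (hX.ae_eq_mk t).symm, hYm, hYc, hYh⟩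

end KolmogorovChentsov

/-! ### Continuous modification of a pre-Brownian motion -/

section PreBrownian

variable {Ω : Type*} {mΩ : MeasurableSpace Ω} {X : ℝ≥0 → Ω → ℝ} {P : Measure Ω}

/-- A pre-Brownian motion satisfies the (a.e.) Kolmogorov condition with exponents `p = 4`,
`q = 2` and constant `M = 3`: since `X t - X s ∼ 𝓝(0, |t - s|)`, `E |X t - X s|⁴ = 3 |t - s|²`.
Only the `IsAEKolmogorovProcess` version holds since `IsPreBrownianReal` only gives
a.e.-measurability of the marginals. Dot-notation extension declared in Mathlib's namespace
`ProbabilityTheory.IsPreBrownianReal`. Kallenberg, *Foundations* (2002), proof of Thm 13.5;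
Degenne–Marion et al., arXiv:2511.20118. [cite: arXiv251120118] -/
def IsPreBrownianReal.isAEKolmogorovProcess : Prop :=
  IsPreBrownianReal X P → IsAEKolmogorovProcess X P 4 2 3

/-- Every pre-Brownian motion admits a modification which is a Brownian motion with *everywhere*
continuous paths, measurable marginals and `B 0 = 0` identically (Kolmogorov–Chentsov applied to
`IsPreBrownianReal.isAEKolmogorovProcess`, then redefined on the null set `{B 0 ≠ 0}`).
Dot-notation extension declared in Mathlib's namespace `ProbabilityTheory.IsPreBrownianReal`.
Kallenberg, *Foundations of Modern Probability* (2002), Thm 13.5; Degenne–Marion et al.,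
arXiv:2511.20118. [cite: arXiv251120118] -/
def IsPreBrownianReal.exists_modification_isBrownianReal : Prop :=
  ∀ [IsProbabilityMeasure P], IsPreBrownianReal X P →
    ∃ B : ℝ≥0 → Ω → ℝ, (∀ t, X t =ᵐ[P] B t) ∧ IsBrownianReal B P ∧ (∀ t, Measurable (B t)) ∧
      (∀ ω, Continuous (B · ω)) ∧ ∀ ω, B 0 ω = 0

end PreBrownian

end ProbabilityTheory

namespace Literature.Probability.Process

/-! ### The canonical space and the pre-Wiener measure -/

/-- The **pre-Wiener measure** on the canonical space `ℝ≥0 → ℝ` (product σ-algebra): the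
Kolmogorov extension (`Literature.Probability.Process.projectiveLimit`, prelude C1) of the Gaussian projective family
`ProbabilityTheory.BrownianReal.projectiveFamily` of finite-dimensional laws of Brownian
motion. Under it the coordinate process is a pre-Brownian motion (`Literature.Probability.Process.isPreBrownianReal_eval`).
Wiener (1923); Kallenberg, *Foundations* (2002), Thm 13.5 / Thm 6.16. [cite: Wiener1923] -/
noncomputable def preWienerMeasure : Measure (ℝ≥0 → ℝ) :=
  projectiveLimit (ι := ℝ≥0) (α := fun _ ↦ ℝ) projectiveFamily

/-- The pre-Wiener measure is a projective limit of the Brownian finite-dimensional laws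
(the Kolmogorov extension theorem, prelude C1 `Literature.Probability.Process.exists_isProjectiveLimit`, applied to
Mathlib's `BrownianReal.isProjectiveMeasureFamily_projectiveFamily`; see
`isProjectiveLimit_preWienerMeasure_of`).  Named fact; the standing hypothesis of the
pre-Wiener API below. Kallenberg, *Foundations* (2002), Thm 6.16.
[cite: Kallenberg2002, Thm 6.16] -/
def isProjectiveLimit_preWienerMeasure : Prop :=
  IsProjectiveLimit (α := fun _ ↦ ℝ) preWienerMeasure projectiveFamily

/-- `isProjectiveLimit_preWienerMeasure` follows from the Kolmogorov extension theorem for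
real-valued families indexed by `ℝ≥0` (the C1 named fact `Literature.Probability.Process.exists_isProjectiveLimit`):
`ℝ` is Polish and `BrownianReal.projectiveFamily` is a projective family of probability
measures (Mathlib). Kallenberg, *Foundations* (2002), Thm 6.16. [folklore] -/
theorem isProjectiveLimit_preWienerMeasure_of
    (h : exists_isProjectiveLimit (ι := ℝ≥0) (α := fun _ ↦ ℝ)) :
    isProjectiveLimit_preWienerMeasure := by
  have hex : ∃ μ, IsProjectiveLimit (α := fun _ ↦ ℝ) μ projectiveFamily :=
    h isProjectiveMeasureFamily_projectiveFamily
  rw [isProjectiveLimit_preWienerMeasure, preWienerMeasure, projectiveLimit, dif_pos hex]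
  exact hex.choose_spec

/-- The pre-Wiener measure is a probability measure (given `isProjectiveLimit_preWienerMeasure`;
Mathlib `IsProjectiveLimit.isProbabilityMeasure`). Kallenberg, *Foundations* (2002), Thm 6.16.
[folklore] -/
theorem isProbabilityMeasure_preWienerMeasure (h : isProjectiveLimit_preWienerMeasure) :
    IsProbabilityMeasure preWienerMeasure :=
  IsProjectiveLimit.isProbabilityMeasure h

/-- The pre-Wiener measure is a probability measure, as an instance keyed on
`[Fact isProjectiveLimit_preWienerMeasure]`. Kallenberg, *Foundations* (2002), Thm 6.16.
[folklore] -/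
instance instIsProbabilityMeasurePreWienerMeasure [h : Fact isProjectiveLimit_preWienerMeasure] :
    IsProbabilityMeasure preWienerMeasure :=
  isProbabilityMeasure_preWienerMeasure h.out

/-- The finite-dimensional marginal of the pre-Wiener measure on the coordinates `I` is
`BrownianReal.projectiveFamily I` (given `isProjectiveLimit_preWienerMeasure`).
Kallenberg, *Foundations* (2002), Thm 13.5. [folklore] -/
theorem preWienerMeasure_map_restrict (h : isProjectiveLimit_preWienerMeasure) (I : Finset ℝ≥0) :
    preWienerMeasure.map I.restrict = projectiveFamily I :=
  h I

/-- The coordinate process `(t, ω) ↦ ω t` on the canonical space is a pre-Brownian motion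
under the pre-Wiener measure (given `isProjectiveLimit_preWienerMeasure`): its
finite-dimensional laws are the projective family by construction.
Kallenberg, *Foundations* (2002), Thm 13.5. [folklore] -/
theorem isPreBrownianReal_eval (h : isProjectiveLimit_preWienerMeasure) :
    IsPreBrownianReal (fun (t : ℝ≥0) (ω : ℝ≥0 → ℝ) ↦ ω t) preWienerMeasure where
  hasLaw I :=
    { aemeasurable := (Finset.measurable_restrict I).aemeasurable
      map_eq := preWienerMeasure_map_restrict h I }

/-! ### Existence of Brownian motion and the canonical Brownian motion -/

/-- **Existence of Brownian motion** (Wiener 1923). On the canonical space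
`(ℝ≥0 → ℝ, preWienerMeasure)` there is a Brownian motion `B` with measurable marginals,
*everywhere* continuous paths and `B 0 = 0` identically (a continuous modification of the
coordinate process, by Kolmogorov–Chentsov). Wiener, *Differential space* (1923); Kallenberg,
*Foundations* (2002), Thm 13.5; Degenne–Marion et al., arXiv:2511.20118.  Named fact (it is
`isPreBrownianReal_eval` combined with the Kolmogorov–Chentsov fact
`IsPreBrownianReal.exists_modification_isBrownianReal`, see
`exists_isBrownianReal_measurable_continuous_of`); the standing hypothesis of the `brownian`
API below. [cite: Wiener1923] -/
def exists_isBrownianReal_measurable_continuous : Prop :=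
  ∃ B : ℝ≥0 → (ℝ≥0 → ℝ) → ℝ, IsBrownianReal B preWienerMeasure ∧ (∀ t, Measurable (B t)) ∧
      (∀ ω, Continuous (B · ω)) ∧ ∀ ω, B 0 ω = 0

/-- `exists_isBrownianReal_measurable_continuous` follows from `isProjectiveLimit_preWienerMeasure`
and the continuous-modification fact `IsPreBrownianReal.exists_modification_isBrownianReal` for
the coordinate process. Kallenberg, *Foundations* (2002), Thm 13.5. [folklore] -/
theorem exists_isBrownianReal_measurable_continuous_of (h : isProjectiveLimit_preWienerMeasure)
    (hmod : IsPreBrownianReal.exists_modification_isBrownianReal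
      (X := fun (t : ℝ≥0) (ω : ℝ≥0 → ℝ) ↦ ω t) (P := preWienerMeasure)) :
    exists_isBrownianReal_measurable_continuous := by
  haveI := isProbabilityMeasure_preWienerMeasure h
  obtain ⟨B, -, hB, hm, hc, h0⟩ := hmod (isPreBrownianReal_eval h)
  exact ⟨B, hB, hm, hc, h0⟩

/-- The **canonical Brownian motion** `brownian : ℝ≥0 → (ℝ≥0 → ℝ) → ℝ` on the canonical space
with the pre-Wiener measure: a process chosen (classical choice) from
`Literature.Probability.Process.exists_isBrownianReal_measurable_continuous`. **Junk value**: the zero process, in the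
(contradictory) case that no such process exists; this makes measurability, path continuity and
`brownian 0 = 0` hold by construction. Wiener (1923); Kallenberg, *Foundations* (2002),
Thm 13.5. [cite: Wiener1923] -/
noncomputable def brownian : ℝ≥0 → (ℝ≥0 → ℝ) → ℝ :=
  open Classical in
  if h : ∃ B : ℝ≥0 → (ℝ≥0 → ℝ) → ℝ, IsBrownianReal B preWienerMeasure ∧
      (∀ t, Measurable (B t)) ∧ (∀ ω, Continuous (B · ω)) ∧ ∀ ω, B 0 ω = 0
    then h.choose else 0

/-- Each marginal `brownian t` of the canonical Brownian motion is measurable (by construction).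
Kallenberg, *Foundations* (2002), Thm 13.5. [folklore] -/
@[fun_prop]
theorem measurable_brownian (t : ℝ≥0) : Measurable (brownian t) := by
  unfold brownian
  by_cases h : ∃ B : ℝ≥0 → (ℝ≥0 → ℝ) → ℝ, IsBrownianReal B preWienerMeasure ∧
      (∀ t, Measurable (B t)) ∧ (∀ ω, Continuous (B · ω)) ∧ ∀ ω, B 0 ω = 0
  · rw [dif_pos h]
    exact h.choose_spec.2.1 t
  · rw [dif_neg h]
    exact measurable_const

/-- Each marginal `brownian t` of the canonical Brownian motion is strongly measurable.
Kallenberg, *Foundations* (2002), Thm 13.5. [folklore] -/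
theorem stronglyMeasurable_brownian (t : ℝ≥0) : StronglyMeasurable (brownian t) :=
  (measurable_brownian t).stronglyMeasurable

/-- Every path `t ↦ brownian t ω` of the canonical Brownian motion is continuous (by
construction). Kallenberg, *Foundations* (2002), Thm 13.5. [folklore] -/
theorem continuous_brownian (ω : ℝ≥0 → ℝ) : Continuous (brownian · ω) := by
  unfold brownian
  by_cases h : ∃ B : ℝ≥0 → (ℝ≥0 → ℝ) → ℝ, IsBrownianReal B preWienerMeasure ∧
      (∀ t, Measurable (B t)) ∧ (∀ ω, Continuous (B · ω)) ∧ ∀ ω, B 0 ω = 0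
  · simp only [dif_pos h]
    exact h.choose_spec.2.2.1 ω
  · simp only [dif_neg h]
    exact continuous_const

/-- The canonical Brownian motion starts at `0` identically: `brownian 0 = 0` (by
construction). Kallenberg, *Foundations* (2002), Thm 13.5. [folklore] -/
@[simp]
theorem brownian_zero : brownian 0 = 0 := by
  unfold brownian
  by_cases h : ∃ B : ℝ≥0 → (ℝ≥0 → ℝ) → ℝ, IsBrownianReal B preWienerMeasure ∧
      (∀ t, Measurable (B t)) ∧ (∀ ω, Continuous (B · ω)) ∧ ∀ ω, B 0 ω = 0
  · simp only [dif_pos h]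
    exact funext h.choose_spec.2.2.2
  · simp only [dif_neg h]
    rfl

/-- The canonical Brownian motion `Literature.Probability.Process.brownian` is a Brownian motion under the pre-Wiener
measure (given the existence fact `exists_isBrownianReal_measurable_continuous`, hypothesis `h`).
Wiener (1923); Kallenberg, *Foundations* (2002), Thm 13.5. [cite: Wiener1923] -/
theorem isBrownianReal_brownian (h : exists_isBrownianReal_measurable_continuous) :
    IsBrownianReal brownian preWienerMeasure := by
  unfold exists_isBrownianReal_measurable_continuous at h
  unfold brownian
  rw [dif_pos h]
  exact h.choose_spec.1

/-- Increments of the canonical Brownian motion are centred Gaussian with variance `|t - s|`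
(Mathlib `IsPreBrownianReal.hasLaw_sub`). Kallenberg, *Foundations* (2002), Thm 13.5. [folklore] -/
theorem hasLaw_brownian_sub (h : exists_isBrownianReal_measurable_continuous) (s t : ℝ≥0) :
    HasLaw (brownian s - brownian t) (gaussianReal 0 (nndist s.1 t.1)) preWienerMeasure :=
  (isBrownianReal_brownian h).toIsPreBrownianReal.hasLaw_sub s t

/-- The canonical Brownian motion has independent increments (Mathlib
`IsPreBrownianReal.hasIndepIncrements`). Kallenberg, *Foundations* (2002), Thm 13.5. [folklore] -/
theorem hasIndepIncrements_brownian (h : exists_isBrownianReal_measurable_continuous) :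
    HasIndepIncrements brownian preWienerMeasure :=
  (isBrownianReal_brownian h).toIsPreBrownianReal.hasIndepIncrements

/-! ### Planar (complex) Brownian motion -/

/-- A complex-valued process `Z : ℝ≥0 → Ω → ℂ` is a **planar (complex) Brownian motion** if its
real and imaginary parts are real Brownian motions (`ProbabilityTheory.IsBrownianReal`) which
are independent as path-valued random variables. Inventory coverage of the notion
`brownian_motion` (planar case); consumed by no target statement in v0.
Kallenberg, *Foundations of Modern Probability* (2002), Ch. 13 and Ch. 18 (conformal
invariance). [folklore] -/
structure IsBrownianComplex {Ω : Type*} [MeasurableSpace Ω] (Z : ℝ≥0 → Ω → ℂ)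
    (P : Measure Ω) : Prop where
  /-- The real part is a real Brownian motion. -/
  re : IsBrownianReal (fun t ω ↦ (Z t ω).re) P
  /-- The imaginary part is a real Brownian motion. -/
  im : IsBrownianReal (fun t ω ↦ (Z t ω).im) P
  /-- The real and imaginary parts are independent processes. -/
  indepFun : IndepFun (fun ω t ↦ (Z t ω).re) (fun ω t ↦ (Z t ω).im) P

/-- **Existence of planar Brownian motion**: on the product of two copies of the canonical
space, `(ω₁, ω₂) ↦ brownian t ω₁ + i • brownian t ω₂` is a complex Brownian motion (independence
of the two coordinates of a product measure). Kallenberg, *Foundations* (2002), Thm 13.5 and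
Lemma 3.10. [cite: Kallenberg2002, Thm 13.5 and Lemma 3.10] -/
def exists_isBrownianComplex : Prop :=
  ∃ Z : ℝ≥0 → (ℝ≥0 → ℝ) × (ℝ≥0 → ℝ) → ℂ,
      IsBrownianComplex Z (preWienerMeasure.prod preWienerMeasure) ∧
      (∀ t, Measurable (Z t)) ∧ (∀ ω, Continuous (Z · ω)) ∧ ∀ ω, Z 0 ω = 0

end Literature.Probability.Process
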